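import Summits.QuantumFields.YangMills.Theses.UnitScaleTilt
import Summits.QuantumFields.YangMills.Theorems.UnitScaleTiltAvgActionDefectFirstOrder

/-!
# Route `UnitScaleTilt` — crux K2 `HistoryTail` (stmt-QuantumFields-18916): THE COARSE PLAQUETTE OF THE (0.4)-AVERAGED FIELD TO FIRST
# ORDER FROM THE LOOP VARIABLES AT ITS FOUR BONDS ONLY — the hypotheses of `AvgActionDefect.dist1_plaqHol_avgFun_le_mean_add` (p437295)
# reduced to what its proof consumes (support file; brick S3-loc₂a, the representation-free half of the localisation)

Fleet lead `ym-ust-18916-p1` (gen 0); split card `CARD-18916-K2-split.md` (evidence #12/#16), remaining piece **S3-loc**, second brick.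
p437295 (`dist1_plaqHol_avgFun_le_mean_add`, seat ym3-torus-p1 g8) proves
`|Ū(∂p′) − 1| ≤ L^{−d} Σ_r Σ_{t,s} |U(∂q_{r,s,t}) − 1| + 435t²` under the GLOBAL `PlaqSmall a U`; its proof consumes that hypothesis only
through the loop variables `W_c(i)` of (0.4) at the FOUR bonds `c₁ … c₄` of `p′` (`|W_c(i) − 1| ≤ t`, the correction factors to first order,
`|corr(c) − 1| ≤ 6t`).  THIS FILE restates the theorem with exactly those loop bounds as hypotheses (`dist1_plaqHol_avgFun_le_mean_add_of_loops`,
proof = p437295's verbatim with the four uses re-sourced; also the loop-level correction-factor bounds `dist1_corr_le_of_loops`,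
`norm_corr_sub_mean_le_of_loops`, `norm_corr_inv_sub_mean_le_of_loops`).  The sibling file `UnitScaleTiltHistoryTailFirstOrderLocal` feeds the
loop bounds from the WALK-LOCAL plaquette smallness of `HistoryTailStokesLocal.dist1_loopHol_le_loc` (p443816) — the localisation the composite
minimisers of (41) need ([Balaban1985UV3] (68): regularity only on `B^j(Λ_j)`).

WHAT THIS IS NOT: nothing of (41)/(47); nothing uses (α).
-/

noncomputable section

open NormedSpace
open scoped BigOperators Matrix.Norms.L2Operator

namespace Summit.QuantumFields.YangMills.Theorems.HistoryTailFirstOrderLoops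

open Literature.MathematicalPhysics.QuantumFieldTheory.Balaban1983to89
open T4Continuum BlockAveraging AveragingRT B10Eq47AxialChi ExpMeanLog LatticeWordStokes BlockAveragingPlaquetteBound
open Summit.QuantumFields.YangMills.Theorems.AvgActionDefect

variable {n : Type*} [Fintype n] [DecidableEq n] [Nonempty n] {P : Params} {j : ℕ}

/-! ## §1 The correction factors from loop bounds -/

section Corr

/-- In the model, `dist1 g = ‖g − 1‖` (operator norm). [folklore] -/
private theorem dist1_su_eq (g : Matrix.specialUnitaryGroup n ℂ) : dist1 g = ‖(g : Matrix n n ℂ) - 1‖ := rfl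

/-- A special unitary matrix has operator norm `≤ 1`. [folklore] -/
private theorem norm_coe_su_le_one (g : Matrix.specialUnitaryGroup n ℂ) : ‖(g : Matrix n n ℂ)‖ ≤ 1 :=
  (UnitaryModel.norm_of_mem_unitaryGroup (Matrix.specialUnitaryGroup_le_unitaryGroup g.2)).le

/-- **`|corr(c) − 1| ≤ 6t` FROM THE LOOP BOUNDS AT `c`** (`|W_c(i) − 1| ≤ t < δ_N`): the guard of (0.4) is inactive and `exp[mean log]` of a
`t`-small family is `6t`-small. [cite: Balaban1987RG1, (0.4) p.253] -/
theorem dist1_corr_le_of_loops {U : GaugeField P j (Matrix.specialUnitaryGroup n ℂ)} {c : PBond P (j + 1)} {t : ℝ}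
    (hl : ∀ i, dist1 (loopHol U c i) ≤ t) (hδ : t < deltaSU n) :
    dist1 (corr (expMeanLogSU (n := n)) U c) ≤ 6 * t := by
  have hsmall : Small (expMeanLogSU (n := n)) U c := fun i => (hl i).trans_lt hδ
  unfold corr
  rw [if_pos hsmall]
  exact dist1_expMeanLogSU_avg_le hl hδ

/-- **THE CORRECTION FACTOR TO FIRST ORDER FROM THE LOOP BOUNDS AT `c`** (`t ≤ 1/10`, `t < δ_N`):
`‖corr(c) − 1 − |Idx|⁻¹ Σ_i (W_c(i) − 1)‖ ≤ 7t²`. [cite: Balaban1987RG1, (0.4) p.253] -/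
theorem norm_corr_sub_mean_le_of_loops {U : GaugeField P j (Matrix.specialUnitaryGroup n ℂ)} {c : PBond P (j + 1)} {t : ℝ}
    (hl : ∀ i, dist1 (loopHol U c i) ≤ t) (ht : t ≤ 1 / 10) (hδ : t < deltaSU n) :
    ‖((corr (expMeanLogSU (n := n)) U c : Matrix.specialUnitaryGroup n ℂ) : Matrix n n ℂ) - 1 -
        ((Fintype.card (Idx P) : ℂ))⁻¹ • ∑ i : Idx P, (((loopHol U c i : Matrix.specialUnitaryGroup n ℂ) : Matrix n n ℂ) - 1)‖ ≤
      7 * t ^ 2 := by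
  rw [coe_corr_eq_eml (fun i => (hl i).trans_lt hδ)]
  exact norm_eml_sub_one_sub_mean_le (fun i => hl i) ht

/-- The same for the inverse correction factor and the inverse loop family. [cite: Balaban1987RG1, (0.5) p.253] -/
theorem norm_corr_inv_sub_mean_le_of_loops {U : GaugeField P j (Matrix.specialUnitaryGroup n ℂ)} {c : PBond P (j + 1)} {t : ℝ}
    (hl : ∀ i, dist1 (loopHol U c i) ≤ t) (ht : t ≤ 1 / 10) (hδ : t < deltaSU n) :
    ‖(((corr (expMeanLogSU (n := n)) U c)⁻¹ : Matrix.specialUnitaryGroup n ℂ) : Matrix n n ℂ) - 1 -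
        ((Fintype.card (Idx P) : ℂ))⁻¹ •
          ∑ i : Idx P, ((((loopHol U c i)⁻¹ : Matrix.specialUnitaryGroup n ℂ) : Matrix n n ℂ) - 1)‖ ≤
      7 * t ^ 2 := by
  rw [coe_corr_inv_eq_eml (fun i => (hl i).trans_lt hδ)]
  refine norm_eml_sub_one_sub_mean_le (fun i => ?_) ht
  rw [← dist1_su_eq, GaugeGroup.dist1_inv]
  exact hl i

end Corr

/-! ## §2 The coarse plaquette to first order from the loop bounds at its four bonds -/

section Plaquette

/-- **THE COARSE PLAQUETTE OF THE (0.4)-AVERAGED FIELD TO FIRST ORDER, FROM THE LOOP BOUNDS AT ITS FOUR BONDS** (standing range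
`j + 1 ≤ m + K`; `SU(N)`): if every loop variable of (0.4) at the bonds `⟨p′₋, μ⟩`, `⟨p′₋ + e_μ, ν⟩`, `⟨p′₋ + e_ν, μ⟩`, `⟨p′₋, ν⟩` is within
`t` of `1`, `t ≤ 1/10`, `t < δ_N`, then `|Ū(∂p′) − 1| ≤ L^{−d} Σ_r Σ_{t′<L} Σ_{s<L} |U(∂q_{r,s,t′}) − 1| + 435·t²` — p437295's theorem with
its four uses of the global hypothesis re-sourced (proof otherwise verbatim). [cite: Balaban1987RG1, (0.4) p.253] -/
theorem dist1_plaqHol_avgFun_le_mean_add_of_loops (hj : j + 1 ≤ P.m + P.K) {τ : ℝ}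
    {U : GaugeField P j (Matrix.specialUnitaryGroup n ℂ)} (ht : τ ≤ 1 / 10) (hδ : τ < deltaSU n) (p : Plaq P (j + 1))
    (hloop : ∀ i : Idx P, dist1 (loopHol U ⟨p.src, p.μ⟩ i) ≤ τ ∧ dist1 (loopHol U ⟨p.src.shift p.μ, p.ν⟩ i) ≤ τ ∧
      dist1 (loopHol U ⟨p.src.shift p.ν, p.μ⟩ i) ≤ τ ∧ dist1 (loopHol U ⟨p.src, p.ν⟩ i) ≤ τ) :
    dist1 (GaugeField.plaqHol (avgFun (expMeanLogSU (n := n)) U) p) ≤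
      ((P.L : ℝ) ^ P.d)⁻¹ * ∑ r : Fin P.d → Fin P.L, ∑ t ∈ Finset.range P.L, ∑ s ∈ Finset.range P.L,
          dist1 (GaugeField.plaqHol U ⟨shiftN (shiftN (Site.blockSite p.src r) p.ν t) p.μ s, p.μ, p.ν, p.hμν⟩) +
        435 * τ ^ 2 := by
  -- notation
  let K : Type := (Fin P.d → Fin P.L) × Equiv.Perm (Fin P.d) × Equiv.Perm (Fin P.d) × Equiv.Perm (Fin P.d) × Equiv.Perm (Fin P.d)
  haveI : Nonempty K := ⟨(fun _ => ⟨0, P.L_pos⟩, 1, 1, 1, 1)⟩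
  -- the coupled index decomposed along the four matched projections `(r,σ₀,σ₁)`, `(r,σ₁,σ₂)`, `(r,σ₃,σ₂)`, `(r,σ₀,σ₃)`
  let e₁ : K ≃ Idx P × (Equiv.Perm (Fin P.d) × Equiv.Perm (Fin P.d)) :=
    ⟨fun k => ((k.1, k.2.1, k.2.2.1), (k.2.2.2.1, k.2.2.2.2)), fun q => (q.1.1, q.1.2.1, q.1.2.2, q.2.1, q.2.2),
      fun _ => rfl, fun _ => rfl⟩
  let e₂ : K ≃ Idx P × (Equiv.Perm (Fin P.d) × Equiv.Perm (Fin P.d)) :=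
    ⟨fun k => ((k.1, k.2.2.1, k.2.2.2.1), (k.2.1, k.2.2.2.2)), fun q => (q.1.1, q.2.1, q.1.2.1, q.1.2.2, q.2.2),
      fun _ => rfl, fun _ => rfl⟩
  let e₃ : K ≃ Idx P × (Equiv.Perm (Fin P.d) × Equiv.Perm (Fin P.d)) :=
    ⟨fun k => ((k.1, k.2.2.2.2, k.2.2.2.1), (k.2.1, k.2.2.1)), fun q => (q.1.1, q.2.1, q.2.2, q.1.2.2, q.1.2.1),
      fun _ => rfl, fun _ => rfl⟩
  let e₄ : K ≃ Idx P × (Equiv.Perm (Fin P.d) × Equiv.Perm (Fin P.d)) :=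
    ⟨fun k => ((k.1, k.2.1, k.2.2.2.2), (k.2.2.1, k.2.2.2.1)), fun q => (q.1.1, q.1.2.1, q.2.1, q.2.2, q.1.2.2),
      fun _ => rfl, fun _ => rfl⟩
  -- the four bonds, correction factors, straight transporters
  set c₁ : PBond P (j + 1) := ⟨p.src, p.μ⟩ with hc₁
  set c₂ : PBond P (j + 1) := ⟨p.src.shift p.μ, p.ν⟩ with hc₂
  set c₃ : PBond P (j + 1) := ⟨p.src.shift p.ν, p.μ⟩ with hc₃
  set c₄ : PBond P (j + 1) := ⟨p.src, p.ν⟩ with hc₄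
  set E₁ : Matrix.specialUnitaryGroup n ℂ := corr (expMeanLogSU (n := n)) U c₁ with hE₁
  set E₂ : Matrix.specialUnitaryGroup n ℂ := corr (expMeanLogSU (n := n)) U c₂ with hE₂
  set E₃ : Matrix.specialUnitaryGroup n ℂ := corr (expMeanLogSU (n := n)) U c₃ with hE₃
  set E₄ : Matrix.specialUnitaryGroup n ℂ := corr (expMeanLogSU (n := n)) U c₄ with hE₄
  set A₁ : Matrix.specialUnitaryGroup n ℂ := axialAvg U c₁ with hA₁
  set A₂ : Matrix.specialUnitaryGroup n ℂ := axialAvg U c₂ with hA₂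
  set A₃ : Matrix.specialUnitaryGroup n ℂ := axialAvg U c₃ with hA₃
  set A₄ : Matrix.specialUnitaryGroup n ℂ := axialAvg U c₄ with hA₄
  -- smallness facts
  have hl₁ : ∀ i, dist1 (loopHol U c₁ i) ≤ τ := fun i => (hloop i).1
  have hl₂ : ∀ i, dist1 (loopHol U c₂ i) ≤ τ := fun i => (hloop i).2.1
  have hl₃ : ∀ i, dist1 (loopHol U c₃ i) ≤ τ := fun i => (hloop i).2.2.1
  have hl₄ : ∀ i, dist1 (loopHol U c₄ i) ≤ τ := fun i => (hloop i).2.2.2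
  have hcorr₁ : dist1 (corr (expMeanLogSU (n := n)) U c₁) ≤ 6 * τ := dist1_corr_le_of_loops hl₁ hδ
  have hcorr₂ : dist1 (corr (expMeanLogSU (n := n)) U c₂) ≤ 6 * τ := dist1_corr_le_of_loops hl₂ hδ
  have hcorr₃ : dist1 (corr (expMeanLogSU (n := n)) U c₃) ≤ 6 * τ := dist1_corr_le_of_loops hl₃ hδ
  have hcorr₄ : dist1 (corr (expMeanLogSU (n := n)) U c₄) ≤ 6 * τ := dist1_corr_le_of_loops hl₄ hδ
  have h6τ : 6 * τ ≤ 1 := by linarith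
  have hτ1 : τ ≤ 1 := by linarith
  -- the four correction factors to first order, means transported to the coupled index
  have hρ₁ : ‖(E₁ : Matrix n n ℂ) - 1 - ((Fintype.card K : ℂ))⁻¹ •
      ∑ k : K, (((loopHol U c₁ (k.1, k.2.1, k.2.2.1) : Matrix.specialUnitaryGroup n ℂ) : Matrix n n ℂ) - 1)‖ ≤ 7 * τ ^ 2 := by
    have h : ((Fintype.card K : ℂ))⁻¹ •
        ∑ k : K, (((loopHol U c₁ (k.1, k.2.1, k.2.2.1) : Matrix.specialUnitaryGroup n ℂ) : Matrix n n ℂ) - 1) =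
        ((Fintype.card (Idx P) : ℂ))⁻¹ • ∑ i : Idx P, (((loopHol U c₁ i : Matrix.specialUnitaryGroup n ℂ) : Matrix n n ℂ) - 1) :=
      mean_comp_fst e₁ (fun i => ((loopHol U c₁ i : Matrix.specialUnitaryGroup n ℂ) : Matrix n n ℂ) - 1)
    rw [h]
    exact norm_corr_sub_mean_le_of_loops hl₁ ht hδ
  have hρ₂ : ‖(E₂ : Matrix n n ℂ) - 1 - ((Fintype.card K : ℂ))⁻¹ •
      ∑ k : K, (((loopHol U c₂ (k.1, k.2.2.1, k.2.2.2.1) : Matrix.specialUnitaryGroup n ℂ) : Matrix n n ℂ) - 1)‖ ≤ 7 * τ ^ 2 := by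
    have h : ((Fintype.card K : ℂ))⁻¹ •
        ∑ k : K, (((loopHol U c₂ (k.1, k.2.2.1, k.2.2.2.1) : Matrix.specialUnitaryGroup n ℂ) : Matrix n n ℂ) - 1) =
        ((Fintype.card (Idx P) : ℂ))⁻¹ • ∑ i : Idx P, (((loopHol U c₂ i : Matrix.specialUnitaryGroup n ℂ) : Matrix n n ℂ) - 1) :=
      mean_comp_fst e₂ (fun i => ((loopHol U c₂ i : Matrix.specialUnitaryGroup n ℂ) : Matrix n n ℂ) - 1)
    rw [h]
    exact norm_corr_sub_mean_le_of_loops hl₂ ht hδ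
  have hρ₃ : ‖((E₃⁻¹ : Matrix.specialUnitaryGroup n ℂ) : Matrix n n ℂ) - 1 - ((Fintype.card K : ℂ))⁻¹ •
      ∑ k : K, ((((loopHol U c₃ (k.1, k.2.2.2.2, k.2.2.2.1))⁻¹ : Matrix.specialUnitaryGroup n ℂ) : Matrix n n ℂ) - 1)‖ ≤
      7 * τ ^ 2 := by
    have h : ((Fintype.card K : ℂ))⁻¹ •
        ∑ k : K, ((((loopHol U c₃ (k.1, k.2.2.2.2, k.2.2.2.1))⁻¹ : Matrix.specialUnitaryGroup n ℂ) : Matrix n n ℂ) - 1) =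
        ((Fintype.card (Idx P) : ℂ))⁻¹ •
          ∑ i : Idx P, ((((loopHol U c₃ i)⁻¹ : Matrix.specialUnitaryGroup n ℂ) : Matrix n n ℂ) - 1) :=
      mean_comp_fst e₃ (fun i => (((loopHol U c₃ i)⁻¹ : Matrix.specialUnitaryGroup n ℂ) : Matrix n n ℂ) - 1)
    rw [h]
    exact norm_corr_inv_sub_mean_le_of_loops hl₃ ht hδ
  have hρ₄ : ‖((E₄⁻¹ : Matrix.specialUnitaryGroup n ℂ) : Matrix n n ℂ) - 1 - ((Fintype.card K : ℂ))⁻¹ •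
      ∑ k : K, ((((loopHol U c₄ (k.1, k.2.1, k.2.2.2.2))⁻¹ : Matrix.specialUnitaryGroup n ℂ) : Matrix n n ℂ) - 1)‖ ≤
      7 * τ ^ 2 := by
    have h : ((Fintype.card K : ℂ))⁻¹ •
        ∑ k : K, ((((loopHol U c₄ (k.1, k.2.1, k.2.2.2.2))⁻¹ : Matrix.specialUnitaryGroup n ℂ) : Matrix n n ℂ) - 1) =
        ((Fintype.card (Idx P) : ℂ))⁻¹ •
          ∑ i : Idx P, ((((loopHol U c₄ i)⁻¹ : Matrix.specialUnitaryGroup n ℂ) : Matrix n n ℂ) - 1) :=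
      mean_comp_fst e₄ (fun i => (((loopHol U c₄ i)⁻¹ : Matrix.specialUnitaryGroup n ℂ) : Matrix n n ℂ) - 1)
    rw [h]
    exact norm_corr_inv_sub_mean_le_of_loops hl₄ ht hδ
  -- helper 1 at these matrices
  have main := norm_prod4_sub_mean_le (𝔸 := Matrix n n ℂ) (κ := K)
    (g₁ := (A₁ : Matrix n n ℂ)) (g₂ := ((A₂ * A₃⁻¹ : Matrix.specialUnitaryGroup n ℂ) : Matrix n n ℂ))
    (g₃ := ((A₄⁻¹ : Matrix.specialUnitaryGroup n ℂ) : Matrix n n ℂ))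
    (X₁ := (E₁ : Matrix n n ℂ) - 1) (X₂ := (E₂ : Matrix n n ℂ) - 1)
    (X₃ := ((E₃⁻¹ : Matrix.specialUnitaryGroup n ℂ) : Matrix n n ℂ) - 1)
    (X₄ := ((E₄⁻¹ : Matrix.specialUnitaryGroup n ℂ) : Matrix n n ℂ) - 1)
    (Y₁ := fun k : K => ((loopHol U c₁ (k.1, k.2.1, k.2.2.1) : Matrix.specialUnitaryGroup n ℂ) : Matrix n n ℂ) - 1)
    (Y₂ := fun k : K => ((loopHol U c₂ (k.1, k.2.2.1, k.2.2.2.1) : Matrix.specialUnitaryGroup n ℂ) : Matrix n n ℂ) - 1)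
    (Y₃ := fun k : K => (((loopHol U c₃ (k.1, k.2.2.2.2, k.2.2.2.1))⁻¹ : Matrix.specialUnitaryGroup n ℂ) : Matrix n n ℂ) - 1)
    (Y₄ := fun k : K => (((loopHol U c₄ (k.1, k.2.1, k.2.2.2.2))⁻¹ : Matrix.specialUnitaryGroup n ℂ) : Matrix n n ℂ) - 1)
    (s := 6 * τ) (t := τ) (ρ := 7 * τ ^ 2)
    (norm_coe_su_le_one _) (norm_coe_su_le_one _) (norm_coe_su_le_one _)
    (by rw [← dist1_su_eq]; exact hcorr₁) (by rw [← dist1_su_eq]; exact hcorr₂)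
    (by rw [← dist1_su_eq, GaugeGroup.dist1_inv]; exact hcorr₃)
    (by rw [← dist1_su_eq, GaugeGroup.dist1_inv]; exact hcorr₄) h6τ
    (fun k => by rw [← dist1_su_eq]; exact hl₁ _) (fun k => by rw [← dist1_su_eq]; exact hl₂ _)
    (fun k => by rw [← dist1_su_eq, GaugeGroup.dist1_inv]; exact hl₃ _)
    (fun k => by rw [← dist1_su_eq, GaugeGroup.dist1_inv]; exact hl₄ _) hτ1 hρ₁ hρ₂ hρ₃ hρ₄
  -- identify the two products with the coarse plaquette and the concatenated loops
  have hprod : (1 + ((E₁ : Matrix n n ℂ) - 1)) * (A₁ : Matrix n n ℂ) * (1 + ((E₂ : Matrix n n ℂ) - 1)) *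
      ((A₂ * A₃⁻¹ : Matrix.specialUnitaryGroup n ℂ) : Matrix n n ℂ) *
      (1 + (((E₃⁻¹ : Matrix.specialUnitaryGroup n ℂ) : Matrix n n ℂ) - 1)) * ((A₄⁻¹ : Matrix.specialUnitaryGroup n ℂ) : Matrix n n ℂ) *
      (1 + (((E₄⁻¹ : Matrix.specialUnitaryGroup n ℂ) : Matrix n n ℂ) - 1)) =
      ((GaugeField.plaqHol (avgFun (expMeanLogSU (n := n)) U) p : Matrix.specialUnitaryGroup n ℂ) : Matrix n n ℂ) := by
    simp only [add_sub_cancel]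
    have : GaugeField.plaqHol (avgFun (expMeanLogSU (n := n)) U) p = E₁ * A₁ * E₂ * (A₂ * A₃⁻¹) * E₃⁻¹ * A₄⁻¹ * E₄⁻¹ := by
      show E₁ * A₁ * (E₂ * A₂) * (E₃ * A₃)⁻¹ * (E₄ * A₄)⁻¹ = _
      group
    rw [this]
    simp only [Submonoid.coe_mul]
  have hloops : ∀ k : K,
      (1 + (((loopHol U c₁ (k.1, k.2.1, k.2.2.1) : Matrix.specialUnitaryGroup n ℂ) : Matrix n n ℂ) - 1)) * (A₁ : Matrix n n ℂ) *
      (1 + (((loopHol U c₂ (k.1, k.2.2.1, k.2.2.2.1) : Matrix.specialUnitaryGroup n ℂ) : Matrix n n ℂ) - 1)) *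
      ((A₂ * A₃⁻¹ : Matrix.specialUnitaryGroup n ℂ) : Matrix n n ℂ) *
      (1 + ((((loopHol U c₃ (k.1, k.2.2.2.2, k.2.2.2.1))⁻¹ : Matrix.specialUnitaryGroup n ℂ) : Matrix n n ℂ) - 1)) *
      ((A₄⁻¹ : Matrix.specialUnitaryGroup n ℂ) : Matrix n n ℂ) *
      (1 + ((((loopHol U c₄ (k.1, k.2.1, k.2.2.2.2))⁻¹ : Matrix.specialUnitaryGroup n ℂ) : Matrix n n ℂ) - 1)) =
      ((loopHol U c₁ (k.1, k.2.1, k.2.2.1) * A₁ * (loopHol U c₂ (k.1, k.2.2.1, k.2.2.2.1) * A₂) *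
          (loopHol U c₃ (k.1, k.2.2.2.2, k.2.2.2.1) * A₃)⁻¹ * (loopHol U c₄ (k.1, k.2.1, k.2.2.2.2) * A₄)⁻¹ :
          Matrix.specialUnitaryGroup n ℂ) : Matrix n n ℂ) := by
    intro k
    simp only [add_sub_cancel]
    have : loopHol U c₁ (k.1, k.2.1, k.2.2.1) * A₁ * (loopHol U c₂ (k.1, k.2.2.1, k.2.2.2.1) * A₂) *
        (loopHol U c₃ (k.1, k.2.2.2.2, k.2.2.2.1) * A₃)⁻¹ * (loopHol U c₄ (k.1, k.2.1, k.2.2.2.2) * A₄)⁻¹ =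
        loopHol U c₁ (k.1, k.2.1, k.2.2.1) * A₁ * loopHol U c₂ (k.1, k.2.2.1, k.2.2.2.1) * (A₂ * A₃⁻¹) *
          (loopHol U c₃ (k.1, k.2.2.2.2, k.2.2.2.1))⁻¹ * A₄⁻¹ * (loopHol U c₄ (k.1, k.2.1, k.2.2.2.2))⁻¹ := by group
    rw [this]
    simp only [Submonoid.coe_mul]
  rw [hprod, Finset.sum_congr rfl fun k _ => hloops k] at main
  -- the distance of each concatenated loop to `1` (helper 2)
  have hP : ∀ k : K, ‖((loopHol U c₁ (k.1, k.2.1, k.2.2.1) * A₁ * (loopHol U c₂ (k.1, k.2.2.1, k.2.2.2.1) * A₂) *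
          (loopHol U c₃ (k.1, k.2.2.2.2, k.2.2.2.1) * A₃)⁻¹ * (loopHol U c₄ (k.1, k.2.1, k.2.2.2.2) * A₄)⁻¹ :
          Matrix.specialUnitaryGroup n ℂ) : Matrix n n ℂ) - 1‖ ≤
      ∑ t ∈ Finset.range P.L, ∑ s ∈ Finset.range P.L,
        dist1 (GaugeField.plaqHol U ⟨shiftN (shiftN (Site.blockSite p.src k.1) p.ν t) p.μ s, p.μ, p.ν, p.hμν⟩) := by
    intro k
    rw [← dist1_su_eq]
    exact dist1_fourLoops_le hj U p k.1 k.2.1 k.2.2.1 k.2.2.2.1 k.2.2.2.2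
  -- the mean of a constant
  have hcK : (0 : ℝ) < Fintype.card K := Nat.cast_pos.mpr Fintype.card_pos
  have hcKC : (Fintype.card K : ℂ) ≠ 0 := by exact_mod_cast hcK.ne'
  have hmean1 : ((Fintype.card K : ℂ))⁻¹ • ∑ _k : K, (1 : Matrix n n ℂ) = 1 := by
    rw [Finset.sum_const, Finset.card_univ, ← Nat.cast_smul_eq_nsmul ℂ, smul_smul, inv_mul_cancel₀ hcKC, one_smul]
  -- assemble: `Ū(∂p′) − 1 = [Ū(∂p′) − mean P_k] + mean (P_k − 1)`
  set M : Matrix n n ℂ := ((GaugeField.plaqHol (avgFun (expMeanLogSU (n := n)) U) p : Matrix.specialUnitaryGroup n ℂ) :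
    Matrix n n ℂ) with hM
  set Pk : K → Matrix n n ℂ := fun k =>
    ((loopHol U c₁ (k.1, k.2.1, k.2.2.1) * A₁ * (loopHol U c₂ (k.1, k.2.2.1, k.2.2.2.1) * A₂) *
        (loopHol U c₃ (k.1, k.2.2.2.2, k.2.2.2.1) * A₃)⁻¹ * (loopHol U c₄ (k.1, k.2.1, k.2.2.2.2) * A₄)⁻¹ :
        Matrix.specialUnitaryGroup n ℂ) : Matrix n n ℂ) with hPk
  have main' : ‖M - ((Fintype.card K : ℂ))⁻¹ • ∑ k : K, Pk k‖ ≤ 4 * (7 * τ ^ 2) + 11 * (6 * τ) ^ 2 + 11 * τ ^ 2 := main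
  have hsplit : M - 1 = (M - ((Fintype.card K : ℂ))⁻¹ • ∑ k : K, Pk k) + ((Fintype.card K : ℂ))⁻¹ • ∑ k : K, (Pk k - 1) := by
    rw [Finset.sum_sub_distrib, smul_sub, hmean1]
    abel
  have hmeanP : ‖((Fintype.card K : ℂ))⁻¹ • ∑ k : K, (Pk k - 1)‖ ≤
      ((P.L : ℝ) ^ P.d)⁻¹ * ∑ r : Fin P.d → Fin P.L, ∑ t ∈ Finset.range P.L, ∑ s ∈ Finset.range P.L,
          dist1 (GaugeField.plaqHol U ⟨shiftN (shiftN (Site.blockSite p.src r) p.ν t) p.μ s, p.μ, p.ν, p.hμν⟩) := by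
    rw [← mean_of_fst (fun r => ∑ t ∈ Finset.range P.L, ∑ s ∈ Finset.range P.L,
          dist1 (GaugeField.plaqHol U ⟨shiftN (shiftN (Site.blockSite p.src r) p.ν t) p.μ s, p.μ, p.ν, p.hμν⟩)),
      norm_smul, norm_inv, Complex.norm_natCast]
    refine mul_le_mul_of_nonneg_left ((norm_sum_le _ _).trans (Finset.sum_le_sum fun k _ => ?_)) (inv_nonneg.mpr hcK.le)
    exact hP k
  rw [dist1_su_eq, ← hM, hsplit]
  refine (norm_add_le _ _).trans ?_
  have h435 : 4 * (7 * τ ^ 2) + 11 * (6 * τ) ^ 2 + 11 * τ ^ 2 = 435 * τ ^ 2 := by ring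
  linarith [main', hmeanP, h435]

end Plaquette

end Summit.QuantumFields.YangMills.Theorems.HistoryTailFirstOrderLoops

end
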